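import Literature.MathematicalPhysics.QuantumFieldTheory.Balaban1983to89.B8Thm2TorusCoverOfEBlockSymJ
import Literature.MathematicalPhysics.QuantumFieldTheory.Balaban1983to89.B9B8KnitLetterRBound
import Literature.MathematicalPhysics.QuantumFieldTheory.Balaban1983to89.B9GeoInputsMultiRateKLevelV1

/-!
# [B8] Thm 2 on the torus — the (J)-discharged cover interface with its WALK GEOMETRY DISCHARGED above one threshold ((T) FILE 5-bis)

T. Bałaban, *Spaces of regular gauge field configurations on a lattice and gauge fixing conditions*, Commun. Math. Phys. **99** (1985) 75–102
[`Balaban1985RegularSpaces`, "[B8]"]; *Propagators for lattice gauge theories in a background field*, Commun. Math. Phys. **99** (1985) 389–434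
[`Balaban1985BackgroundPropagators`, "[B9]"]; *Propagators and renormalization transformations for lattice gauge theories. II*, Commun. Math. Phys. **96** (1984)
223–250 [`Balaban1984PropagatorsII`, "[4]"].  statement-level skeleton of published theorems with citation tags; proofs where landed; nothing here is a claim
about the Yang–Mills mass gap

THE PRINT.  [B9] p. 398 remark after (3.47) («we may replace the factor (Lʲη)^α by (Lʲη)^β(L^{j′}η)^γ»), Thm 3.9 p. 413 («For M sufficiently large»), p. 408
l. 30–34; [4] Lemma 2.1 (2.54) p. 233, (2.60)–(2.63) p. 234; [B8] Thm 2 p. 83, p. 77 («Ω_j = T_η»: every shape-member of the torus knit has ONE level).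

WHY THIS FILE (cell `lit-balaban`; seat t2s-1 gen 10).  t2s-1's 5c (`B8Thm2TorusCoverOfEBlockSymJ.hThm2Cover_of_prop6_eBlockSymData`) displays, besides the
def-Y's-side statements (1ₛ) ∧ (Eₛ) ∧ (Dₛ) and the numeric windows, the members' walk geometry: `hgeo` (3 facts at the E-block rate) and `hgeoJ` (22 facts at the
junction's rate ladder: (2.54), `d(y,y) = 0`, (2.61)∕(2.63) at nine (rate, fraction) pairs, seven scale transfers of `ℓ, ℓ², ℓ⁻¹, ℓ⁻⁴`).  THIS FILE discharges
both above ONE threshold `A₀` on the big-block exponent `a′` (print's «M sufficiently large»): (2.54) and `d(y,y) = 0` hold on every member, (2.61)∕(2.63) at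
each pair above an `M`-threshold (p21's `geo_inputs3_geo9K`, four times), and — because every shape-member of the torus knit has CONSTANT level (its box IS
`T_η` at one scale, [B8] p. 77) — every scale transfer holds with constant `1` and NO size condition (`scaleTransfer_constLev`: all block scales are equal,
J-B `B9B8KnitLetterRBound.geo9K_len_constLev`); `hgeo` is G9's `exists_geo_threshold`.  The interface of record thereby displays (1ₛ) ∧ (Eₛ) ∧ (Dₛ) and
NUMERIC windows only.

WHAT THIS FILE PROVES (THEOREMS; 0 `def`, 0 `def … : Prop`, 0 sorry; standard axioms).
* §1 `scaleTransfer_constLev` (constant level ⇒ every weight that is a function of the block scale transfers with constant `1` at every exponent `αδ ≥ 0`),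
  ★★ `exists_geoJ_threshold` (the 22-fact bundle of 5c with all transfer constants `1`, above one threshold, for every constant-level member),
  `rateLadder_nonvacuous` (v1.1: the displayed rate ∕ fraction hypotheses are simultaneously satisfiable — an explicit rational witness).
* §2 ★★ `jBinder_of_symBinder_constLev` (5c §2 with `hgeoJ` in the constant-level form), ★★★★★ `hThm2Cover_of_prop6_eBlockSymData_exists` — 5c §4 with `hgeo`
  and `hgeoJ` DISCHARGED: given `τ = tr`, `M ≥ 1`, `(δ_E, α)`, `len`, a basis `b`, `Rr, Hp, Hg` and the junction's rate ladder (rates ∕ fractions with positive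
  products, the three budgets), THERE ARE `d′`, the nine (2.61)-dimensions and `A₀` such that for every `a′ ≥ A₀`, every `B_E > 0`, every class size `α₀′` and
  def-Y's-side constants with the junction's named constants (transfer constants `1`) and windows, FILE 4's windows with `κ′ = κ_J·M₂Σ‖b_j‖·c₁(d_W,δ_W₂,α_W₂)`:
  `∃ a₀′ > 0, ∃ k₀, ∃ c_α > 0, ∀ c_L …, ∃ B₁ B₂ c₁ > 0, ∀ F : T3Family, F.L = ℓ+1 → ∀ n < K`, [(1ₛ) ∧ (Eₛ) ∧ (Dₛ)] → `P ∣ P′ ∧ L^{K−n} ∣ P ∧ Thm2TorusAt …`.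

HONEST SCOPE ∕ NOT CLAIMED.  (1ₛ), (Eₛ), (Dₛ) and the numeric windows stay DISPLAYED; thresholds and constants explicit, not optimised; `stub_PV3A` NOT
discharged; no summit ∕ node statement proved; nothing continuum ∕ ℝ⁴ ∕ OS — the Yang–Mills mass gap is NOT proved by any of this (Track A conditional rung).
No `sorry`, no `axiom`, no `… : Prop` fact, no `instance`, no `notation`, no `def`.  v1.1 (append protocol): §1-bis `rateLadder_nonvacuous` added; nothing
landed is modified.  `--supports stmt-QuantumFields-19200` as helper.  Net new unproved facts: 0.

RELATED IN THE TREE, NOT DUPLICATED (searched 2026-08-29: `rg 'scaleTransfer_constLev|geoJ_threshold|SymData_exists' Literature/` = ∅): 5c (USED BY NAME), G9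
`exists_geo_threshold` (USED BY NAME), p33 `B9Thm32CinvAtKnitLetterOfCubeData.geo_ladder` (the from-cube-data lineage's ladder at fractions ½ with size
conditions — here the constant level makes the transfers free), J-B `B9B8KnitLetterRBound.scaleTransfer_of_constLev` (exponent `0`; §1 is every exponent).
-/

noncomputable section

namespace Literature.MathematicalPhysics.QuantumFieldTheory.Balaban1983to89.B8Thm2TorusCoverOfEBlockSymJExists

open scoped BigOperators
open Node00 B6KLevelCensusIndexV1
open B7Prop1Explicit renaming Site → LSite
open B7Prop1Explicit (e)
open B7Prop2Explicit (unitaryUnits C0 c2')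
open B6GlobalChartV1 (PV blkV1)
open B6Geom246MultiLevelBox (blkOf)
open B6Ineq2142KLevelV1 (β)
open B6RandomWalk (HasMajorant Ineq260 Ineq261 Ineq263 Triangle254 c1_nonneg)
open B9Thm34Ext (toB6)
open B9FromB6 (EBlock)
open B9CubeLettersInvReadings (kernelFamilyBInv)
open B9GeoNormsKLevelV1 (geo9K geo9K_dist_nonneg)
open B9GeoLemma21KLevelV1 (geo9K_len_pos)
open B9GeoInputsMultiRateKLevelV1 (geo_inputs3_geo9K)
open B9RWSums347DefiniteFaces (exp261)
open B9Ineq347 (ScaleTransfer)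
open B9Eq352DivFormLetters (conj)
open B9Eq352GradLetters (diffLetter)
open B9Eq3104CutoffCommutators (DPDsY)
open B9B8KnitLetterRBound (geo9K_len_constLev)
open B8Thm2TorusCoverOfEBlock (exists_geo_threshold)
open B8Thm2TorusCoverOfEBlockSym (hThm2Cover_of_prop6_eBlockSym)
open B8Thm2TorusCoverOfEBlockSymJ (shiftCfg_of_isPeriodic jAt_of_symData)
open B8Thm2TorusOfProp6DeltaAFour (exists_exponent_ge)
open B12Ineq417Flat (shiftCfg)
open B8Ineq132 (InAk)
open B8Thm2TorusLettersPerOfKnit (bgY)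
open B9B8AveragingJunction (parKnitY)
open B9Eq316AveragingTransposeZd (betaTau alphaQ)
open B7Prop2SpecialUnitary (specialUnitaryUnits)
open B8Thm2TorusAt (Thm2TorusAt)
open T4TermwiseTorus (IsPeriodic)
open scoped Matrix Matrix.Norms.L2Operator

variable {d ℓ : ℕ} {hd : 1 ≤ d + 1} {hL : Odd (ℓ + 1) ∧ 1 < ℓ + 1} {b₀ b₁ : ℝ} {N : ℕ}

/-! ## §1  The walk geometry of a constant-level member: free scale transfers; (2.61)∕(2.63) above one threshold -/

section Geometry

/-- ★ **ON A CONSTANT-LEVEL MEMBER EVERY SCALE TRANSFER IS FREE**: all block scales equal `Lⁿ∕|c_f|`, so for every weight `w = f(ℓ(·)) ≥ 0`, every exponent with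
`αδ ≥ 0` and every constant `C ≥ 1`: `e^{−αδd(y,y′)}w(y′) ≤ C·w(y)`. [cite: Balaban1985BackgroundPropagators, p.398 remark after (3.47); Balaban1985RegularSpaces, p.77 («Ω_j = T_η»); Balaban1984PropagatorsII, (2.60) p.234] -/
theorem scaleTransfer_constLev (i : KIdx d ℓ hd hL b₀ b₁) {n : ℕ} (hD : ∀ x, i.D.lev x = n) {δ α C : ℝ} (hαδ : 0 ≤ α * δ) (hC : 1 ≤ C)
    (w : (geo9K i).Site → ℝ) (f : ℝ → ℝ) (hw : ∀ a, w a = f ((geo9K i).len a)) (hw0 : ∀ a, 0 ≤ w a) :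
    ScaleTransfer (geo9K i) δ α C w := by
  have hlev : ∀ z : SiteY i, levY i z = n := fun z => hD z.1
  intro y y'
  have hyy : w y' = w y := by rw [hw, hw, geo9K_len_constLev i hlev, geo9K_len_constLev i hlev]
  have hexp : Real.exp (-(α * δ * (geo9K i).dist y y')) ≤ 1 :=
    Real.exp_le_one_iff.2 (neg_nonpos.2 (mul_nonneg hαδ (geo9K_dist_nonneg i y y')))
  calc Real.exp (-(α * δ * (geo9K i).dist y y')) * w y' ≤ 1 * w y' := mul_le_mul_of_nonneg_right hexp (hw0 y')
    _ = w y := by rw [one_mul, hyy]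
    _ ≤ C * w y := le_mul_of_one_le_left (hw0 y) hC

/-- `M ≥ M_h = L^{a′}`. [cite: Balaban1984PropagatorsII, (2.1)–(2.2) p.224, bookkeeping] -/
theorem pow_le_geo9K_M {b₀' b₁' : ℝ} (i : KIdx d ℓ hd hL b₀' b₁') {a' : ℕ} (hMh : i.Mh = (ℓ + 1) ^ a') : (((ℓ + 1) ^ a' : ℕ) : ℝ) ≤ (geo9K i).M := by
  have hL1 : (1 : ℝ) ≤ ((ℓ + 1 : ℕ) : ℝ) := by exact_mod_cast Nat.succ_le_succ (Nat.zero_le ℓ)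
  have hM : (geo9K i).M = ((ℓ + 1 : ℕ) : ℝ) * (((ℓ + 1) ^ a' : ℕ) : ℝ) := by
    show (((ℓ + 1 : ℕ) : ℝ)) * (i.Mh : ℝ) = _
    rw [hMh]
  rw [hM]; exact le_mul_of_one_le_left (by positivity) hL1

/-- ★★ **THE JUNCTION's WALK GEOMETRY ABOVE ONE THRESHOLD**: for the rate ladder with positive (rate × fraction) products there are (2.61)-dimensions
`d_g, d_b, d₁, …, d₅, d_B, d_W` and a threshold `A₀` such that every constant-level member with `M_h = L^{a′}`, `a′ ≥ A₀`, carries 5c's 22-fact bundle `hgeoJ` at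
the walk letter `R = 1` with all transfer constants `1`: (2.54), `d(y,y) = 0` (every member), (2.61)∕(2.63) at the nine pairs (`geo_inputs3_geo9K` ×4), the seven
scale transfers (free, §1). [cite: Balaban1984PropagatorsII, Lemma 2.1 (2.54) p.233, (2.60)–(2.63) p.234; Balaban1985BackgroundPropagators, p.398, Thm 3.9 p.413; Balaban1985RegularSpaces, p.77] -/
theorem exists_geoJ_threshold {b₀' b₁' : ℝ} [instF' : ∀ i : KIdx d ℓ hd hL b₀' b₁', Fintype (geo9K i).Site] (hℓ1 : 1 ≤ ℓ) (Hg : Prop)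
    {δ₀ αg δb αb βb δ δ₁ δ₂ δ₃ αst α' αC δ₅ α₅ β₅ δB αB βB δW₁ αW₁ δW₂ αW₂ : ℝ}
    (hδ₀ : 0 ≤ δ₀) (hαg1 : αg ≤ 1) (pαg : 0 < αg * δ₀) (pαb : 0 < αb * δb) (pβb : 0 < βb * δb) (pαst : 0 < αst * δ) (pαst₁ : 0 < αst * δ₁)
    (pαst₂ : 0 < αst * δ₂) (p₁ : 0 < α' * ((1 - αst) * δ)) (p₂ : 0 < α' * ((1 - αst) * δ₁)) (p₃ : 0 < α' * ((1 - αst) * δ₂)) (hδ₃0 : 0 ≤ δ₃) (hαC1 : αC ≤ 1)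
    (pαC : 0 < αC * δ₃) (pα₅ : 0 < α₅ * δ₅) (pβ₅ : 0 < β₅ * δ₅) (pαB : 0 < αB * δB) (pβB : 0 < βB * δB) (pαW₁ : 0 < αW₁ * δW₁) (pαW₂ : 0 < αW₂ * δW₂) :
    ∃ dg db d₁ d₂ d₃ d₄ d₅ dB dW A₀ : ℕ, ∀ a' : ℕ, A₀ ≤ a' → ∀ i : KIdx d ℓ hd hL b₀' b₁', i.Mh = (ℓ + 1) ^ a' → ∀ n : ℕ, (∀ x, i.D.lev x = n) →
      (Triangle254 (toB6 (geo9K i) 1 Hg) ∧ (∀ y : (geo9K i).Site, (geo9K i).dist y y = 0) ∧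
        Ineq261 dg (toB6 (geo9K i) 1 Hg) δ₀ αg ∧ Ineq263 dg (toB6 (geo9K i) 1 Hg) δ₀ αg ∧
        Ineq261 db (toB6 (geo9K i) 1 Hg) δb βb ∧ ScaleTransfer (geo9K i) δb αb 1 (fun a => (geo9K i).len a) ∧
        ScaleTransfer (geo9K i) δb αb 1 (fun a => (geo9K i).len a ^ 2) ∧
        ScaleTransfer (geo9K i) δ αst 1 (fun a => (geo9K i).len a ^ 2) ∧ Ineq261 d₁ (toB6 (geo9K i) 1 Hg) ((1 - αst) * δ) α' ∧
        ScaleTransfer (geo9K i) δ₁ αst 1 (fun a => (geo9K i).len a ^ 2) ∧ Ineq261 d₂ (toB6 (geo9K i) 1 Hg) ((1 - αst) * δ₁) α' ∧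
        ScaleTransfer (geo9K i) δ₂ αst 1 (fun a => ((geo9K i).len a ^ 4)⁻¹) ∧ Ineq261 d₃ (toB6 (geo9K i) 1 Hg) ((1 - αst) * δ₂) α' ∧
        Ineq261 d₄ (toB6 (geo9K i) 1 Hg) δ₃ αC ∧ Ineq263 d₄ (toB6 (geo9K i) 1 Hg) δ₃ αC ∧
        Ineq261 d₅ (toB6 (geo9K i) 1 Hg) δ₅ β₅ ∧ ScaleTransfer (geo9K i) δ₅ α₅ 1 (fun a => ((geo9K i).len a ^ 4)⁻¹) ∧
        Ineq261 dB (toB6 (geo9K i) 1 Hg) δB βB ∧ ScaleTransfer (geo9K i) δB αB 1 (fun a => (geo9K i).len a) ∧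
        ScaleTransfer (geo9K i) δB αB 1 (fun a => ((geo9K i).len a ^ 4)⁻¹) ∧
        ScaleTransfer (geo9K i) δW₁ αW₁ 1 (fun a => ((geo9K i).len a)⁻¹) ∧ Ineq261 dW (toB6 (geo9K i) 1 Hg) δW₂ αW₂) := by
  -- (2.61)∕(2.63) at the nine pairs, above four `M`-thresholds
  obtain ⟨MA, hMA⟩ := geo_inputs3_geo9K (d := d) (ℓ := ℓ) (hd := hd) (hL := hL) (b₀ := b₀') (b₁ := b₁') (fun _ => (1 : ℝ)) (fun _ => Hg)
    (δ₁ := δb) (α₁ := βb) (δ₂ := (1 - αst) * δ) (α₂ := α') (δ₃ := δ₀) (α₃ := αg) pβb p₁ pαg hδ₀ hαg1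
  obtain ⟨MB, hMB⟩ := geo_inputs3_geo9K (d := d) (ℓ := ℓ) (hd := hd) (hL := hL) (b₀ := b₀') (b₁ := b₁') (fun _ => (1 : ℝ)) (fun _ => Hg)
    (δ₁ := (1 - αst) * δ₁) (α₁ := α') (δ₂ := (1 - αst) * δ₂) (α₂ := α') (δ₃ := δ₃) (α₃ := αC) p₂ p₃ pαC hδ₃0 hαC1
  obtain ⟨MC, hMC⟩ := geo_inputs3_geo9K (d := d) (ℓ := ℓ) (hd := hd) (hL := hL) (b₀ := b₀') (b₁ := b₁') (fun _ => (1 : ℝ)) (fun _ => Hg)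
    (δ₁ := δ₅) (α₁ := β₅) (δ₂ := δB) (α₂ := βB) (δ₃ := δ₀) (α₃ := αg) pβ₅ pβB pαg hδ₀ hαg1
  obtain ⟨MD, hMD⟩ := geo_inputs3_geo9K (d := d) (ℓ := ℓ) (hd := hd) (hL := hL) (b₀ := b₀') (b₁ := b₁') (fun _ => (1 : ℝ)) (fun _ => Hg)
    (δ₁ := δW₂) (α₁ := αW₂) (δ₂ := δ₀) (α₂ := αg) (δ₃ := δ₀) (α₃ := αg) pαW₂ pαg pαg hδ₀ hαg1
  obtain ⟨A₀, -, hA₀⟩ := exists_exponent_ge hℓ1 ⌈max (max MA MB) (max MC MD)⌉₊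
  refine ⟨max (exp261 (geo9K (d := d) (ℓ := ℓ) (hd := hd) (hL := hL) (b₀ := b₀') (b₁ := b₁')) ((1 - αst) * δ) α')
      (exp261 (geo9K (d := d) (ℓ := ℓ) (hd := hd) (hL := hL) (b₀ := b₀') (b₁ := b₁')) δ₀ αg),
    exp261 (geo9K (d := d) (ℓ := ℓ) (hd := hd) (hL := hL) (b₀ := b₀') (b₁ := b₁')) δb βb,
    max (exp261 (geo9K (d := d) (ℓ := ℓ) (hd := hd) (hL := hL) (b₀ := b₀') (b₁ := b₁')) ((1 - αst) * δ) α')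
      (exp261 (geo9K (d := d) (ℓ := ℓ) (hd := hd) (hL := hL) (b₀ := b₀') (b₁ := b₁')) δ₀ αg),
    exp261 (geo9K (d := d) (ℓ := ℓ) (hd := hd) (hL := hL) (b₀ := b₀') (b₁ := b₁')) ((1 - αst) * δ₁) α',
    max (exp261 (geo9K (d := d) (ℓ := ℓ) (hd := hd) (hL := hL) (b₀ := b₀') (b₁ := b₁')) ((1 - αst) * δ₂) α')
      (exp261 (geo9K (d := d) (ℓ := ℓ) (hd := hd) (hL := hL) (b₀ := b₀') (b₁ := b₁')) δ₃ αC),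
    max (exp261 (geo9K (d := d) (ℓ := ℓ) (hd := hd) (hL := hL) (b₀ := b₀') (b₁ := b₁')) ((1 - αst) * δ₂) α')
      (exp261 (geo9K (d := d) (ℓ := ℓ) (hd := hd) (hL := hL) (b₀ := b₀') (b₁ := b₁')) δ₃ αC),
    exp261 (geo9K (d := d) (ℓ := ℓ) (hd := hd) (hL := hL) (b₀ := b₀') (b₁ := b₁')) δ₅ β₅,
    max (exp261 (geo9K (d := d) (ℓ := ℓ) (hd := hd) (hL := hL) (b₀ := b₀') (b₁ := b₁')) δB βB)
      (exp261 (geo9K (d := d) (ℓ := ℓ) (hd := hd) (hL := hL) (b₀ := b₀') (b₁ := b₁')) δ₀ αg),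
    exp261 (geo9K (d := d) (ℓ := ℓ) (hd := hd) (hL := hL) (b₀ := b₀') (b₁ := b₁')) δW₂ αW₂,
    A₀, fun a' ha' i hMh n hD => ?_⟩
  -- `M ≥ L^{a′} ≥ ⌈max⌉ ≥ every threshold`
  have hpow : ((⌈max (max MA MB) (max MC MD)⌉₊ : ℕ) : ℝ) ≤ (((ℓ + 1) ^ a' : ℕ) : ℝ) := by
    exact_mod_cast hA₀.trans (Nat.pow_le_pow_right (Nat.succ_pos ℓ) ha')
  have hmax : max (max MA MB) (max MC MD) ≤ (geo9K i).M := ((Nat.le_ceil _).trans hpow).trans (pow_le_geo9K_M i hMh)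
  obtain ⟨htri, hrefl, -, -, hA1, hA2, hA3, hA3'⟩ := hMA i ((le_max_left _ _).trans ((le_max_left _ _).trans hmax))
  obtain ⟨-, -, -, -, hB1, hB2, hB3, hB3'⟩ := hMB i ((le_max_right _ _).trans ((le_max_left _ _).trans hmax))
  obtain ⟨-, -, -, -, hC1, hC2, -, -⟩ := hMC i ((le_max_left _ _).trans ((le_max_right _ _).trans hmax))
  obtain ⟨-, -, -, -, hD1, -, -, -⟩ := hMD i ((le_max_right _ _).trans ((le_max_right _ _).trans hmax))
  -- the seven scale transfers are free on a constant-level member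
  have hw1 : ∀ a : (geo9K i).Site, 0 ≤ (geo9K i).len a := fun a => (geo9K_len_pos i a).le
  have hw2 : ∀ a : (geo9K i).Site, 0 ≤ (geo9K i).len a ^ 2 := fun a => sq_nonneg _
  have hwi : ∀ a : (geo9K i).Site, 0 ≤ ((geo9K i).len a)⁻¹ := fun a => inv_nonneg.2 (hw1 a)
  have hw4 : ∀ a : (geo9K i).Site, 0 ≤ ((geo9K i).len a ^ 4)⁻¹ := fun a => inv_nonneg.2 (pow_nonneg (hw1 a) 4)
  exact ⟨htri, hrefl, hA3, hA3', hA1, scaleTransfer_constLev i hD pαb.le le_rfl _ (fun x => x) (fun _ => rfl) hw1,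
    scaleTransfer_constLev i hD pαb.le le_rfl _ (fun x => x ^ 2) (fun _ => rfl) hw2,
    scaleTransfer_constLev i hD pαst.le le_rfl _ (fun x => x ^ 2) (fun _ => rfl) hw2, hA2,
    scaleTransfer_constLev i hD pαst₁.le le_rfl _ (fun x => x ^ 2) (fun _ => rfl) hw2, hB1,
    scaleTransfer_constLev i hD pαst₂.le le_rfl _ (fun x => (x ^ 4)⁻¹) (fun _ => rfl) hw4, hB2, hB3, hB3', hC1,
    scaleTransfer_constLev i hD pα₅.le le_rfl _ (fun x => (x ^ 4)⁻¹) (fun _ => rfl) hw4, hC2,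
    scaleTransfer_constLev i hD pαB.le le_rfl _ (fun x => x) (fun _ => rfl) hw1,
    scaleTransfer_constLev i hD pαB.le le_rfl _ (fun x => (x ^ 4)⁻¹) (fun _ => rfl) hw4,
    scaleTransfer_constLev i hD pαW₁.le le_rfl _ (fun x => x⁻¹) (fun _ => rfl) hwi, hD1⟩


/-! ## §1-bis  The junction's rate ladder is inhabited -/

/-- **NON-VACUITY OF THE RATE LADDER**: the twenty-four rates ∕ fractions with ALL the sign conditions, the three Lemma-2.1 budgets and 2b §3's split that
`exists_geoJ_threshold` and `hThm2Cover_of_prop6_eBlockSymData_exists` display are simultaneously satisfiable (all fractions `½`, rates `1, ½, ⅛, 1∕32, 1∕128, …`),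
so the interface's rate hypotheses are not contradictory. [cite: Balaban1984PropagatorsII, Lemma 2.1 (2.60)–(2.63) p.234 («a decay rate arbitrarily close»), bookkeeping] -/
theorem rateLadder_nonvacuous : ∃ δ₀ αg δc δb αb βb δ δ₁ δ₂ δ₃ αst α' αC δ₅ α₅ β₅ δB αB βB ρ δW₁ αW₁ δW₂ αW₂ : ℝ,
      0 ≤ δ₀ ∧ αg ≤ 1 ∧ 0 < αg * δ₀ ∧ 0 ≤ (1 - αg) * δ₀ ∧ 0 ≤ δc ∧ 0 < αb * δb ∧ 0 < βb * δb ∧ 0 ≤ αb ∧ 0 ≤ βb ∧ 0 ≤ δb ∧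
      δc + (αb + βb) * δb ≤ (1 - αg) * δ₀ ∧ δ ≤ (1 - αg) * δ₀ ∧ δ₁ = (1 - α') * ((1 - αst) * δ) ∧ δ₂ = (1 - α') * ((1 - αst) * δ₁) ∧
      δ₃ = (1 - α') * ((1 - αst) * δ₂) ∧ 0 < αst * δ ∧ 0 < αst * δ₁ ∧ 0 < αst * δ₂ ∧ 0 ≤ α' ∧ α' ≤ 1 ∧ 0 ≤ (1 - αst) * δ ∧ 0 ≤ (1 - αst) * δ₁ ∧
      0 ≤ (1 - αst) * δ₂ ∧ 0 < α' * ((1 - αst) * δ) ∧ 0 < α' * ((1 - αst) * δ₁) ∧ 0 < α' * ((1 - αst) * δ₂) ∧ 0 ≤ δ₃ ∧ 0 ≤ αC ∧ αC ≤ 1 ∧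
      0 < αC * δ₃ ∧ 0 ≤ (1 - αC) * δ₃ ∧ 0 < α₅ * δ₅ ∧ 0 < β₅ * δ₅ ∧ 0 ≤ α₅ ∧ 0 ≤ β₅ ∧ 0 ≤ δ₅ ∧ δc + 2 * (α₅ + β₅) * δ₅ ≤ (1 - αC) * δ₃ ∧
      0 < αB * δB ∧ 0 < βB * δB ∧ 0 ≤ ρ ∧ 0 ≤ αB ∧ 0 ≤ βB ∧ 0 ≤ δB ∧ ρ + (2 * αB + βB) * δB ≤ δc ∧ 0 < αW₁ * δW₁ ∧ 0 < αW₂ * δW₂ ∧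
      αW₁ * δW₁ + αW₂ * δW₂ ≤ ρ := by
  refine ⟨1, 1 / 2, 1 / 1024, 1 / 8, 1 / 2, 1 / 2, 1 / 2, 1 / 8, 1 / 32, 1 / 128, 1 / 2, 1 / 2, 1 / 2, 1 / 1024, 1 / 2, 1 / 2, 1 / 8192, 1 / 2, 1 / 2, 1 / 4096, 1 / 8192, 1 / 2, 1 / 8192, 1 / 2, ?_⟩
  norm_num

end Geometry

/-! ## §2  The binder transformer with the constant-level geometry, and the interface of record with the geometry discharged -/

section Binder

variable [instF : ∀ i : KIdx d ℓ hd hL 1 1, Fintype (geo9K i).Site] [instD : ∀ i : KIdx d ℓ hd hL 1 1, DecidableEq (geo9K i).Site]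

/-- ★★ **FILE 4's BINDER FROM [(1ₛ) ∧ (Eₛ) ∧ (Dₛ)] WITH THE GEOMETRY IN THE CONSTANT-LEVEL FORM** (5c §2; all transfer constants `1`; `hgeoJ` may use the member's
constant level). [cite: Balaban1985RegularSpaces, Thm 2 p.83, (1.7) p.77; Balaban1985BackgroundPropagators, (3.25)–(3.27) p.394–395, (3.49) p.399; Balaban1984PropagatorsII, (2.50)–(2.55) p.232, Lemma 2.1 (2.60)–(2.61) p.234; Balaban1985Averaging, (52)–(53) pp.26–27] -/
theorem jBinder_of_symBinder_constLev [Nonempty (Fin N)] {a' K' m K : ℕ} {η aT : ℝ} {Hg : Prop} {δE BE : ℝ}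
    {ι : Type} [Fintype ι] [DecidableEq ι] (b : Module.Basis ι ℝ (Matrix (Fin N) (Fin N) ℂ)) {M₂ : ℝ} (hM₂ : 0 ≤ M₂)
    (hrepr : ∀ (v : (Matrix (Fin N) (Fin N) ℂ)) (j : ι), |b.repr v j| ≤ M₂ * ‖v‖)
    {δ₀ αg δc δb αb βb δ δ₁ δ₂ δ₃ αst α' αC δ₅ α₅ β₅ δB αB βB ρ δW₁ αW₁ δW₂ αW₂ : ℝ}
    (pαg : 0 < αg * δ₀) (hαδg : 0 ≤ (1 - αg) * δ₀) (hδc : 0 ≤ δc) (hαb : 0 ≤ αb) (hβb : 0 ≤ βb) (hδb : 0 ≤ δb) (hrb : δc + (αb + βb) * δb ≤ (1 - αg) * δ₀)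
    (hδ : δ ≤ (1 - αg) * δ₀) (hδ₁ : δ₁ = (1 - α') * ((1 - αst) * δ)) (hδ₂ : δ₂ = (1 - α') * ((1 - αst) * δ₁)) (hδ₃ : δ₃ = (1 - α') * ((1 - αst) * δ₂))
    (pαst : 0 < αst * δ) (pαst₁ : 0 < αst * δ₁) (pαst₂ : 0 < αst * δ₂) (hα'0 : 0 ≤ α') (hα'1 : α' ≤ 1) (hδ' : 0 ≤ (1 - αst) * δ) (hδ'₂ : 0 ≤ (1 - αst) * δ₁)
    (hδ'₃ : 0 ≤ (1 - αst) * δ₂) (hαC0 : 0 ≤ αC) (hαδ₄ : 0 ≤ (1 - αC) * δ₃) (hα₅ : 0 ≤ α₅) (hβ₅ : 0 ≤ β₅) (hδ₅ : 0 ≤ δ₅)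
    (hr₅ : δc + 2 * (α₅ + β₅) * δ₅ ≤ (1 - αC) * δ₃) (hρ : 0 ≤ ρ) (hαB : 0 ≤ αB) (hβB : 0 ≤ βB) (hδB : 0 ≤ δB) (hrB : ρ + (2 * αB + βB) * δB ≤ δc)
    (hsplit : αW₁ * δW₁ + αW₂ * δW₂ ≤ ρ)
    (dg db d₁ d₂ d₃ d₄ d₅ dB dW : ℕ)
    {α₀' : ℝ} (hα₀ : 0 < α₀') (hα₀3 : C0 (d + 1) * α₀' ≤ 1 / 3) (hα₀2 : 2 * α₀' ≤ c2' (d + 1) (ℓ + 1))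
    (hslack : aT * (((ℓ + 1 : ℕ) : ℝ)) ^ (2 * 1) < α₀')
    {A A₁ A₂ KT : ℝ} (hA : 0 ≤ A) (hA₁ : 0 ≤ A₁) (hA₂ : 0 ≤ A₂) (hK : 0 ≤ KT)
    {θE AK : ℝ} (hθE : θE = 32 * ((d : ℝ) + 1) ^ 2 * α₀' * (M₂ * ∑ j, ‖b j‖))
    (hAK : AK = A * B6.c1 dg δ₀ αg * (1 - θE * A * B6.c1 dg δ₀ αg)⁻¹) (hsmallg : θE * A * B6.c1 dg δ₀ αg < 1)
    {θF : ℝ} (hθF : θF = (2 * (8 * ((d : ℝ) + 1) ^ 2 * α₀') * (M₂ * ∑ j, ‖b j‖)) * (M₂ * ∑ j, ‖b j‖) * (A * A * 1 * B6.c1 d₁ ((1 - αst) * δ) α') +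
          (M₂ * ∑ j, ‖b j‖) * (M₂ * ∑ j, ‖b j‖) * ((A + AK) * (AK * (θE * A) * 1 * B6.c1 d₁ ((1 - αst) * δ) α') * 1 * B6.c1 d₂ ((1 - αst) * δ₁) α') +
          (M₂ * ∑ j, ‖b j‖) * ((2 * (8 * ((d : ℝ) + 1) ^ 2 * α₀') * (M₂ * ∑ j, ‖b j‖))) * (AK * AK * 1 * B6.c1 d₁ ((1 - αst) * δ) α'))
    (hsmall : θF * KT * 1 * B6.c1 d₃ ((1 - αst) * δ₂) α' * B6.c1 d₄ δ₃ αC < 1)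
    {KK : ℝ} (hKK : KK = KT * B6.c1 d₄ δ₃ αC * (1 - θF * KT * 1 * B6.c1 d₃ ((1 - αst) * δ₂) α' * B6.c1 d₄ δ₃ αC)⁻¹)
    {κQ θQ BX θX BY θY B₁ θC κJ : ℝ} (hκQ : κQ = M₂ * ∑ j, ‖b j‖) (hθQ : θQ = 2 * (8 * ((d : ℝ) + 1) ^ 2 * α₀') * (M₂ * ∑ j, ‖b j‖))
    (hBX : BX = A₁ * (1 + B6.c1 dg δ₀ αg * (θE * A * B6.c1 dg δ₀ αg * (1 - θE * A * B6.c1 dg δ₀ αg)⁻¹)))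
    (hθX : θX = BX * θE * A * 1 * B6.c1 db δb βb) (hBY : BY = ((d : ℝ) + 1) * A₂) (hθY : θY = AK * θE * BY * 1 * B6.c1 db δb βb)
    (hB₁ : B₁ = max KT KK) (hθC : θC = B₁ * B₁ * θF * 1 * B6.c1 d₅ δ₅ β₅ ^ 2)
    (hκJ : κJ = 1 ^ 4 * B6.c1 dB δB βB ^ 2 *
      (κQ * κQ * θX * B₁ * BY + κQ * θQ * BX * B₁ * BY + κQ * κQ * BX * θC * BY + θQ * κQ * BX * B₁ * BY + κQ * κQ * BX * B₁ * θY))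
    (hgeoJ : ∀ i : KIdx d ℓ hd hL 1 1, i.Mh = (ℓ + 1) ^ a' → ∀ n : ℕ, (∀ x, i.D.lev x = n) →
      (Triangle254 (toB6 (geo9K i) 1 Hg) ∧ (∀ y : (geo9K i).Site, (geo9K i).dist y y = 0) ∧
        Ineq261 dg (toB6 (geo9K i) 1 Hg) δ₀ αg ∧ Ineq263 dg (toB6 (geo9K i) 1 Hg) δ₀ αg ∧
        Ineq261 db (toB6 (geo9K i) 1 Hg) δb βb ∧ ScaleTransfer (geo9K i) δb αb 1 (fun a => (geo9K i).len a) ∧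
        ScaleTransfer (geo9K i) δb αb 1 (fun a => (geo9K i).len a ^ 2) ∧
        ScaleTransfer (geo9K i) δ αst 1 (fun a => (geo9K i).len a ^ 2) ∧ Ineq261 d₁ (toB6 (geo9K i) 1 Hg) ((1 - αst) * δ) α' ∧
        ScaleTransfer (geo9K i) δ₁ αst 1 (fun a => (geo9K i).len a ^ 2) ∧ Ineq261 d₂ (toB6 (geo9K i) 1 Hg) ((1 - αst) * δ₁) α' ∧
        ScaleTransfer (geo9K i) δ₂ αst 1 (fun a => ((geo9K i).len a ^ 4)⁻¹) ∧ Ineq261 d₃ (toB6 (geo9K i) 1 Hg) ((1 - αst) * δ₂) α' ∧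
        Ineq261 d₄ (toB6 (geo9K i) 1 Hg) δ₃ αC ∧ Ineq263 d₄ (toB6 (geo9K i) 1 Hg) δ₃ αC ∧
        Ineq261 d₅ (toB6 (geo9K i) 1 Hg) δ₅ β₅ ∧ ScaleTransfer (geo9K i) δ₅ α₅ 1 (fun a => ((geo9K i).len a ^ 4)⁻¹) ∧
        Ineq261 dB (toB6 (geo9K i) 1 Hg) δB βB ∧ ScaleTransfer (geo9K i) δB αB 1 (fun a => (geo9K i).len a) ∧
        ScaleTransfer (geo9K i) δB αB 1 (fun a => ((geo9K i).len a ^ 4)⁻¹) ∧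
        ScaleTransfer (geo9K i) δW₁ αW₁ 1 (fun a => ((geo9K i).len a)⁻¹) ∧ Ineq261 dW (toB6 (geo9K i) 1 Hg) δW₂ αW₂))
    (hΔS : letI : CStarAlgebra (Matrix (Fin N) (Fin N) ℂ) := {}
      ∀ (i : KIdx d ℓ hd hL 1 1) (m' : ℕ), 1 ≤ m' → m' ≤ K' → i.k = m' + 1 → (∀ x, i.D.lev x = m') → i.Mh = (ℓ + 1) ^ a' →
        i.cf = (((ℓ + 1 : ℕ) : ℝ)) ^ (m' + 1) →
        (∀ ι : IBondY i, i.w ι = i.cf ^ 2 * (((((ℓ + 1 : ℕ) : ℝ)) ^ (ι.1.1 : ℕ)) ^ (d + 1) * (1 / (((ℓ + 1 : ℕ) : ℝ)) ^ (ι.1.1 : ℕ)) ^ 2)) →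
        (PV d ℓ i.m i.K hd hL).sitesPerDir 0 = (PV d ℓ m K hd hL).sitesPerDir 0 →
        ∀ (α₀ : ℝ) (U₀ : LSite (d + 1) → Fin (d + 1) → (Matrix (Fin N) (Fin N) ℂ)ˣ),
        (∀ x κ, U₀ x κ ∈ B7Prop2Explicit.unitaryUnits (Matrix (Fin N) (Fin N) ℂ)) →
        IsPeriodic ((PV d ℓ m K hd hL).sitesPerDir 0) U₀ → 0 < α₀ → α₀ ≤ aT →
        InAk (ℓ + 1) m' η α₀ (fun _ => (Set.univ : Set (LSite (d + 1)))) U₀ →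
        IsUnit (deltaAY i (parSymY i) (parBY i) (GpY i (parSymY i)) (bgY i U₀)) ∧
          (∀ (B : B9.Backgrounds) (cfg : B.Cfg → CfgY (Matrix (Fin N) (Fin N) ℂ) i) (par : BondParY (Matrix (Fin N) (Fin N) ℂ) i) (U₁ : B.Cfg),
            cfg U₁ = bgY i U₀ →
            EBlock (kernelFamilyBInv i B cfg (GAY i (parSymY i) (parBY i) (GpY i (parSymY i))) par) BE δE U₁) ∧
        (∀ ιB : BlkY i → IBondY i, (∀ s, β i.hN i.D i.hk (ιB s) = s) →
            HasMajorant (g := toB6 (geo9K i) 1 Hg) (fun p : SiteY i × ι => ιB (blkOf i.D.toDomains p.1))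
                (conj b ((etaS i ^ 2) • (GpY i (parSymY i) (bgY i U₀)).restrictScalars ℝ))
                (fun a a' => A * (geo9K i).len a ^ 2 * Real.exp (-(δ₀ * (geo9K i).dist a a'))) ∧
              (∀ μ : Fin (d + 1), HasMajorant (g := toB6 (geo9K i) 1 Hg) (fun p : SiteY i × ι => ιB (blkOf i.D.toDomains p.1))
                (conj b (diffLetter (shiftY i) (UboxY i (bgY i U₀)) ((|i.cf| : ℝ) : ℂ) (Sum.inl μ)) *
                  conj b ((etaS i ^ 2) • (GpY i (parSymY i) (bgY i U₀)).restrictScalars ℝ))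
                (fun a a' => A₁ * (geo9K i).len a * Real.exp (-(δ₀ * (geo9K i).dist a a')))) ∧
              (∀ ν : Fin (d + 1), HasMajorant (g := toB6 (geo9K i) 1 Hg) (fun p : SiteY i × ι => ιB (blkOf i.D.toDomains p.1))
                (conj b ((etaS i ^ 2) • (GpY i (parSymY i) (bgY i U₀)).restrictScalars ℝ) *
                  conj b (diffLetter (shiftY i) (UboxY i (bgY i U₀)) ((|i.cf| : ℝ) : ℂ) (Sum.inr ν)))
                (fun a a' => A₂ * (geo9K i).len a * Real.exp (-(δ₀ * (geo9K i).dist a a')))) ∧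
              HasMajorant (g := toB6 (geo9K i) 1 Hg) (fun q : BlkY i × ι => ιB q.1)
                (conj b ((etaS i ^ 2 * etaS i ^ 2)⁻¹ • (XinvY i (parSymY i) (GpY i (parSymY i)) (bgY i U₀)).restrictScalars ℝ))
                (fun a a' => KT * ((geo9K i).len a ^ 4)⁻¹ * Real.exp (-(δ₀ * (geo9K i).dist a a'))))) :
    letI : CStarAlgebra (Matrix (Fin N) (Fin N) ℂ) := {}
    ∀ (i : KIdx d ℓ hd hL 1 1) (m' : ℕ), 1 ≤ m' → m' ≤ K' → i.k = m' + 1 → (∀ x, i.D.lev x = m') → i.Mh = (ℓ + 1) ^ a' →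
      i.cf = (((ℓ + 1 : ℕ) : ℝ)) ^ (m' + 1) →
      (∀ ι : IBondY i, i.w ι = i.cf ^ 2 * (((((ℓ + 1 : ℕ) : ℝ)) ^ (ι.1.1 : ℕ)) ^ (d + 1) * (1 / (((ℓ + 1 : ℕ) : ℝ)) ^ (ι.1.1 : ℕ)) ^ 2)) →
      (PV d ℓ i.m i.K hd hL).sitesPerDir 0 = (PV d ℓ m K hd hL).sitesPerDir 0 →
      ∀ (α₀ : ℝ) (U₀ : LSite (d + 1) → Fin (d + 1) → (Matrix (Fin N) (Fin N) ℂ)ˣ),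
      (∀ x κ, U₀ x κ ∈ B7Prop2Explicit.unitaryUnits (Matrix (Fin N) (Fin N) ℂ)) →
      IsPeriodic ((PV d ℓ m K hd hL).sitesPerDir 0) U₀ → 0 < α₀ → α₀ ≤ aT →
      InAk (ℓ + 1) m' η α₀ (fun _ => (Set.univ : Set (LSite (d + 1)))) U₀ →
      IsUnit (deltaAY i (parSymY i) (parBY i) (GpY i (parSymY i)) (bgY i U₀)) ∧
        (∀ (B : B9.Backgrounds) (cfg : B.Cfg → CfgY (Matrix (Fin N) (Fin N) ℂ) i) (par : BondParY (Matrix (Fin N) (Fin N) ℂ) i) (U₁ : B.Cfg),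
          cfg U₁ = bgY i U₀ →
          EBlock (kernelFamilyBInv i B cfg (GAY i (parSymY i) (parBY i) (GpY i (parSymY i))) par) BE δE U₁) ∧
      (∀ A, wNormBY i (-3) ((DPDsY i (parSymY i) (GpY i (parSymY i)) (bgY i U₀) - DPDsY i (parKnitY i) (GpY i (parKnitY i)) (bgY i U₀)) A) ≤
          (κJ * (M₂ * ∑ j, ‖b j‖) * 1 * B6.c1 dW δW₂ αW₂) * wNormBY i (-1) A) := by
  intro i m' hm1 hmK hk hD hMh hcf hw hPV α₀ U₀ hU₀ hperI hα0 hαT hIn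
  obtain ⟨h1, hE, hdata⟩ := hΔS i m' hm1 hmK hk hD hMh hcf hw hPV α₀ U₀ hU₀ hperI hα0 hαT hIn
  refine ⟨h1, hE, ?_⟩
  have hper : ∀ μ : Fin (d + 1), shiftCfg ((((PV d ℓ i.m i.K hd hL).sitesPerDir 0 : ℕ) : ℤ) • e μ) U₀ = U₀ := by
    rw [hPV]; exact shiftCfg_of_isPeriodic hperI
  exact jAt_of_symData i hk hD hcf hU₀ hper hα0 hαT hIn b hM₂ hrepr hα₀ hα₀3 hα₀2 hslack hA hA₁ hA₂ hK dg hαδg pαg.le hθE hAK hsmallg db zero_le_one hδc hαb hβb hδb hrb d₁ d₂ d₃ d₄ hδ hδ₁ hδ₂ hδ₃ zero_le_one zero_le_one pαst.le hα'0 hα'1 hδ' pαst₁.le hδ'₂ pαst₂.le hδ'₃ hαC0 hαδ₄ hθF hsmall hKK d₅ le_rfl hα₅ hβ₅ hδ₅ hr₅ dB le_rfl hρ hαB hβB hδB hrB dW zero_le_one hsplit hκQ hθQ hBX hθX hBY hθY hB₁ hθC hκJ (hgeoJ i hMh m' hD) hdata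

end Binder

/-! ## §3 ★★★★★ The interface of record, `d + 1 = 3`, `SU(2)`: (J) discharged, walk geometry discharged -/

section Cover

open B8Thm2T3FamilyBinder (P_eq_PV)
open T3ContinuumYM3Torus (T3Family)
open T3SectALandauChart (eta eta_pos)

variable {hd₃ : 1 ≤ 2 + 1}
variable [instF : ∀ i : KIdx 2 ℓ hd₃ hL 1 1, Fintype (geo9K i).Site] [instD : ∀ i : KIdx 2 ℓ hd₃ hL 1 1, DecidableEq (geo9K i).Site]

/-- ★★★★★ **THE TORUS THM 2 INTERFACE OF RECORD — BINDER AT `parSymY`, (J) DISCHARGED, WALK GEOMETRY DISCHARGED** (`d + 1 = 3`, `N = 2`).  For `τ = tr`, `M ≥ 1`,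
the E-block rate data `δ_E > 0`, `0 < α < 1`, `len`, a basis `b` with coordinate bound `M₂`, `Rr, Hp, Hg`, and the junction's rate ladder (rates ∕ fractions with
positive products, the three Lemma-2.1 budgets and 2b §3's split): THERE ARE `d′`, the nine (2.61)-dimensions `d_g, d_b, d₁, …, d₅, d_B, d_W` and a threshold `A₀`
such that for every big-block exponent `a′ ≥ A₀`, every `B_E > 0`, every `a_T` in FILE 4's windows with F7's numeric condition at `B₀ = 2B_Ec₁L⁴`, every class
size `α₀′` one level above `a_T`, all def-Y's-side constants `A, A₁, A₂, K_T ≥ 0` with the junction's named constants (transfer constants `1`) in their windows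
(J-B file 9's, 23c's) and FILE 4's junction window at `κ′ = κ_J·M₂Σ‖b_j‖·1·c₁(d_W,δ_W₂,α_W₂)`: `∃ a₀′ > 0, ∃ k₀, ∃ c_α > 0, ∀ c_L …, ∃ B₁ B₂ c₁ > 0, ∀ F :
T3Family, F.L = ℓ + 1 → ∀ n < K`, [(1ₛ) `IsUnit Δ_a(bgY i U₀; parSymY)` ∧ (Eₛ) `EBlock (kernelFamilyBInv i B cfg (GAY i (parSymY i) (parBY i) (GpY i (parSymY i))) par)
B_E δ_E U₁` ∧ (Dₛ) def-Y's-side block-majorant data at `bgY i U₀` (walk letter `R = 1`) for every section, at the cover torus' shape-members] → `P ∣ P′ ∧ L^{K−n} ∣ P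
∧ Thm2TorusAt (ℓ+1) (K − n) P′ (eta F n K) 0 B₁ B₂ c₁ len SU(2) ⊤`.  The ONLY displayed hypotheses left are def-Y's-side statements at `parSymY` ((1ₛ), (Eₛ): M5.7's
endpoint currency; (Dₛ): M5.5 ∕ M5.6 output shapes) and numeric windows.  HONEST SCOPE: those displayed; `stub_PV3A` NOT discharged; no summit ∕ node statement
proved; nothing continuum ∕ ℝ⁴ ∕ OS — the Yang–Mills mass gap is NOT proved by any of this.
[cite: Balaban1985RegularSpaces, Thm 2 p.83, (1.29) p.81, (1.33)–(1.39) pp.82–83, (1.7) p.77, (1.58)–(1.60) pp.86–87; Balaban1985BackgroundPropagators, p.408 l.30–34, p.398, Thm 3.9 p.413, (3.19) p.393, (3.25)–(3.27) p.394–395, (3.40)–(3.42) p.397, (3.47)–(3.49) pp.398–399, Thm 3.3 p.399, (3.101) p.414, (3.106) p.414, Thm 3.11 p.416; Balaban1984PropagatorsII, (2.50)–(2.55) p.232, Lemma 2.1 (2.54) p.233, (2.59)–(2.63) p.234, (2.66) p.234; Balaban1985Averaging, (52)–(53) pp.26–27; Balaban1985UV3, (1)–(3) p.256] -/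
theorem hThm2Cover_of_prop6_eBlockSymData_exists (hℓ : 4 ≤ ℓ)
    (τ : (Matrix (Fin 2) (Fin 2) ℂ) →ₗ[ℂ] ℂ) (hτ : ∀ a, τ a = Matrix.trace a) (hτt : ∀ a b, τ (a * b) = τ (b * a))
    {Cτ : ℝ} (hCτ : ∀ x y : (Matrix (Fin 2) (Fin 2) ℂ), |(τ (star x * y)).re| ≤ Cτ * ‖x‖ * ‖y‖)
    {M : ℝ} (hM1 : 1 ≤ M) {δE α : ℝ} (hδE : 0 < δE) (hαE0 : 0 < α) (hα1 : α < 1)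
    {len : LSite (2 + 1) → ℝ}
    {ι : Type} [Fintype ι] [DecidableEq ι] (b : Module.Basis ι ℝ (Matrix (Fin 2) (Fin 2) ℂ)) {M₂ : ℝ} (hM₂ : 0 ≤ M₂)
    (hrepr : ∀ (v : (Matrix (Fin 2) (Fin 2) ℂ)) (j : ι), |b.repr v j| ≤ M₂ * ‖v‖)
    (Rr : ℝ) (Hp Hg : Prop)
    {δ₀ αg δc δb αb βb δ δ₁ δ₂ δ₃ αst α' αC δ₅ α₅ β₅ δB αB βB ρ δW₁ αW₁ δW₂ αW₂ : ℝ}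
    (hδ₀ : 0 ≤ δ₀) (hαg1 : αg ≤ 1) (pαg : 0 < αg * δ₀) (hαδg : 0 ≤ (1 - αg) * δ₀) (hδc : 0 ≤ δc) (pαb : 0 < αb * δb) (pβb : 0 < βb * δb) (hαb : 0 ≤ αb)
    (hβb : 0 ≤ βb) (hδb : 0 ≤ δb) (hrb : δc + (αb + βb) * δb ≤ (1 - αg) * δ₀) (hδ : δ ≤ (1 - αg) * δ₀) (hδ₁ : δ₁ = (1 - α') * ((1 - αst) * δ))
    (hδ₂ : δ₂ = (1 - α') * ((1 - αst) * δ₁)) (hδ₃ : δ₃ = (1 - α') * ((1 - αst) * δ₂)) (pαst : 0 < αst * δ) (pαst₁ : 0 < αst * δ₁) (pαst₂ : 0 < αst * δ₂)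
    (hα'0 : 0 ≤ α') (hα'1 : α' ≤ 1) (hδ' : 0 ≤ (1 - αst) * δ) (hδ'₂ : 0 ≤ (1 - αst) * δ₁) (hδ'₃ : 0 ≤ (1 - αst) * δ₂) (p₁ : 0 < α' * ((1 - αst) * δ))
    (p₂ : 0 < α' * ((1 - αst) * δ₁)) (p₃ : 0 < α' * ((1 - αst) * δ₂)) (hδ₃0 : 0 ≤ δ₃) (hαC0 : 0 ≤ αC) (hαC1 : αC ≤ 1) (pαC : 0 < αC * δ₃)
    (hαδ₄ : 0 ≤ (1 - αC) * δ₃) (pα₅ : 0 < α₅ * δ₅) (pβ₅ : 0 < β₅ * δ₅) (hα₅ : 0 ≤ α₅) (hβ₅ : 0 ≤ β₅) (hδ₅ : 0 ≤ δ₅)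
    (hr₅ : δc + 2 * (α₅ + β₅) * δ₅ ≤ (1 - αC) * δ₃) (pαB : 0 < αB * δB) (pβB : 0 < βB * δB) (hρ : 0 ≤ ρ) (hαB : 0 ≤ αB) (hβB : 0 ≤ βB) (hδB : 0 ≤ δB)
    (hrB : ρ + (2 * αB + βB) * δB ≤ δc) (pαW₁ : 0 < αW₁ * δW₁) (pαW₂ : 0 < αW₂ * δW₂) (hsplit : αW₁ * δW₁ + αW₂ * δW₂ ≤ ρ) :
    letI : CStarAlgebra (Matrix (Fin 2) (Fin 2) ℂ) := {}
    ∃ d' dg db d₁ d₂ d₃ d₄ d₅ dB dW A₀ : ℕ, ∀ a' : ℕ, A₀ ≤ a' → ∀ BE : ℝ, 0 < BE →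
    ∀ aT : ℝ, 0 < aT → aT ≤ alphaQ (2 + 1) (ℓ + 1) / ((ℓ + 1 : ℕ) : ℝ) ^ 2 → C0 (2 + 1) * aT ≤ 1 / 3 → 2 * aT ≤ c2' (2 + 1) (ℓ + 1) →
      2 * ((48 * (((2 : ℕ) : ℝ) + 1) + 14 * ((2 : ℕ) : ℝ) * M + (32 * (((2 : ℕ) : ℝ) + 2) ^ 2 +
        12 * (((2 : ℕ) : ℝ) + 1) ^ 2 * (13344 * (((2 : ℕ) : ℝ) + 1) * (((2 : ℕ) : ℝ) + 2) ^ 2 * (((2 : ℕ) : ℝ) + 5) * (((ℓ + 1 : ℕ) : ℝ)) ^ (2 + 4)) *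
          (Cτ * betaTau τ))) * aT) * (2 * (BE * B6.c1 d' δE (1 - α) * (((ℓ + 1 : ℕ) : ℝ)) ^ 4)) ≤ 1 →
    ∀ {α₀' : ℝ} (hα₀ : 0 < α₀') (hα₀3 : C0 (2 + 1) * α₀' ≤ 1 / 3) (hα₀2 : 2 * α₀' ≤ c2' (2 + 1) (ℓ + 1))
    (hslack : aT * (((ℓ + 1 : ℕ) : ℝ)) ^ (2 * 1) < α₀')
    {A A₁ A₂ KT : ℝ} (hA : 0 ≤ A) (hA₁ : 0 ≤ A₁) (hA₂ : 0 ≤ A₂) (hK : 0 ≤ KT)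
    {θE AK : ℝ} (hθE : θE = 32 * (((2 : ℕ) : ℝ) + 1) ^ 2 * α₀' * (M₂ * ∑ j, ‖b j‖))
    (hAK : AK = A * B6.c1 dg δ₀ αg * (1 - θE * A * B6.c1 dg δ₀ αg)⁻¹) (hsmallg : θE * A * B6.c1 dg δ₀ αg < 1)
    {θF : ℝ} (hθF : θF = (2 * (8 * (((2 : ℕ) : ℝ) + 1) ^ 2 * α₀') * (M₂ * ∑ j, ‖b j‖)) * (M₂ * ∑ j, ‖b j‖) * (A * A * 1 * B6.c1 d₁ ((1 - αst) * δ) α') +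
          (M₂ * ∑ j, ‖b j‖) * (M₂ * ∑ j, ‖b j‖) * ((A + AK) * (AK * (θE * A) * 1 * B6.c1 d₁ ((1 - αst) * δ) α') * 1 * B6.c1 d₂ ((1 - αst) * δ₁) α') +
          (M₂ * ∑ j, ‖b j‖) * ((2 * (8 * (((2 : ℕ) : ℝ) + 1) ^ 2 * α₀') * (M₂ * ∑ j, ‖b j‖))) * (AK * AK * 1 * B6.c1 d₁ ((1 - αst) * δ) α'))
    (hsmall : θF * KT * 1 * B6.c1 d₃ ((1 - αst) * δ₂) α' * B6.c1 d₄ δ₃ αC < 1)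
    {KK : ℝ} (hKK : KK = KT * B6.c1 d₄ δ₃ αC * (1 - θF * KT * 1 * B6.c1 d₃ ((1 - αst) * δ₂) α' * B6.c1 d₄ δ₃ αC)⁻¹)
    {κQ θQ BX θX BY θY B₁ θC κJ : ℝ} (hκQ : κQ = M₂ * ∑ j, ‖b j‖) (hθQ : θQ = 2 * (8 * (((2 : ℕ) : ℝ) + 1) ^ 2 * α₀') * (M₂ * ∑ j, ‖b j‖))
    (hBX : BX = A₁ * (1 + B6.c1 dg δ₀ αg * (θE * A * B6.c1 dg δ₀ αg * (1 - θE * A * B6.c1 dg δ₀ αg)⁻¹)))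
    (hθX : θX = BX * θE * A * 1 * B6.c1 db δb βb) (hBY : BY = (((2 : ℕ) : ℝ) + 1) * A₂) (hθY : θY = AK * θE * BY * 1 * B6.c1 db δb βb)
    (hB₁ : B₁ = max KT KK) (hθC : θC = B₁ * B₁ * θF * 1 * B6.c1 d₅ δ₅ β₅ ^ 2)
    (hκJ : κJ = 1 ^ 4 * B6.c1 dB δB βB ^ 2 *
      (κQ * κQ * θX * B₁ * BY + κQ * θQ * BX * B₁ * BY + κQ * κQ * BX * θC * BY + θQ * κQ * BX * B₁ * BY + κQ * κQ * BX * B₁ * θY)),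
    2 * (((((2 : ℕ) : ℝ) + 3) * (BE * B6.c1 d' δE (1 - α) * (((ℓ + 1 : ℕ) : ℝ)) ^ 4)) * (κJ * (M₂ * ∑ j, ‖b j‖) * 1 * B6.c1 dW δW₂ αW₂)) ≤ 1 →
    ∃ a₀' : ℝ, 0 < a₀' ∧ ∃ k₀ : ℕ, ∃ cα : ℝ, 0 < cα ∧
    ∀ cL : ℝ, 0 < cL → cL * (((ℓ + 1 : ℕ) : ℝ)) ^ 2 < a₀' →
      cL ≤ min (1 / 16) (min aT (min aT (1 / (2 * (2 * (2 * (BE * B6.c1 d' δE (1 - α) * (((ℓ + 1 : ℕ) : ℝ)) ^ 4))) * (14 * ((2 + 1 - 1 : ℕ) : ℝ)) * M + 1)))) →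
      cL ≤ cα →
    ∃ B₁' B₂ c₁ : ℝ, 0 < B₁' ∧ 0 < B₂ ∧ 0 < c₁ ∧
    ∀ F : T3Family, F.L = ℓ + 1 → ∀ (n K : ℕ), n < K →
      (∀ (i : KIdx 2 ℓ hd₃ hL 1 1) (m' : ℕ), 1 ≤ m' → m' ≤ K - n → i.k = m' + 1 → (∀ x, i.D.lev x = m') → i.Mh = (ℓ + 1) ^ a' →
        i.cf = (((ℓ + 1 : ℕ) : ℝ)) ^ (m' + 1) →
        (∀ ι : IBondY i, i.w ι = i.cf ^ 2 * (((((ℓ + 1 : ℕ) : ℝ)) ^ (ι.1.1 : ℕ)) ^ (2 + 1) * (1 / (((ℓ + 1 : ℕ) : ℝ)) ^ (ι.1.1 : ℕ)) ^ 2)) →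
        (PV 2 ℓ i.m i.K hd₃ hL).sitesPerDir 0 = (PV 2 ℓ (F.m + k₀) K hd₃ hL).sitesPerDir 0 →
        ∀ (α₀ : ℝ) (U₀ : LSite (2 + 1) → Fin (2 + 1) → (Matrix (Fin 2) (Fin 2) ℂ)ˣ),
        (∀ x κ, U₀ x κ ∈ B7Prop2Explicit.unitaryUnits (Matrix (Fin 2) (Fin 2) ℂ)) →
        IsPeriodic ((PV 2 ℓ (F.m + k₀) K hd₃ hL).sitesPerDir 0) U₀ → 0 < α₀ → α₀ ≤ aT →
        InAk (ℓ + 1) m' (eta F n K) α₀ (fun _ => (Set.univ : Set (LSite (2 + 1)))) U₀ →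
          IsUnit (deltaAY i (parSymY i) (parBY i) (GpY i (parSymY i)) (bgY i U₀)) ∧
          (∀ (B : B9.Backgrounds) (cfg : B.Cfg → CfgY (Matrix (Fin 2) (Fin 2) ℂ) i) (par : BondParY (Matrix (Fin 2) (Fin 2) ℂ) i) (U₁ : B.Cfg),
            cfg U₁ = bgY i U₀ →
            EBlock (kernelFamilyBInv i B cfg (GAY i (parSymY i) (parBY i) (GpY i (parSymY i))) par) BE δE U₁) ∧
          (∀ ιB : BlkY i → IBondY i, (∀ s, β i.hN i.D i.hk (ιB s) = s) →
              HasMajorant (g := toB6 (geo9K i) 1 Hg) (fun p : SiteY i × ι => ιB (blkOf i.D.toDomains p.1))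
                  (conj b ((etaS i ^ 2) • (GpY i (parSymY i) (bgY i U₀)).restrictScalars ℝ))
                  (fun a a' => A * (geo9K i).len a ^ 2 * Real.exp (-(δ₀ * (geo9K i).dist a a'))) ∧
                (∀ μ : Fin (2 + 1), HasMajorant (g := toB6 (geo9K i) 1 Hg) (fun p : SiteY i × ι => ιB (blkOf i.D.toDomains p.1))
                  (conj b (diffLetter (shiftY i) (UboxY i (bgY i U₀)) ((|i.cf| : ℝ) : ℂ) (Sum.inl μ)) *
                    conj b ((etaS i ^ 2) • (GpY i (parSymY i) (bgY i U₀)).restrictScalars ℝ))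
                  (fun a a' => A₁ * (geo9K i).len a * Real.exp (-(δ₀ * (geo9K i).dist a a')))) ∧
                (∀ ν : Fin (2 + 1), HasMajorant (g := toB6 (geo9K i) 1 Hg) (fun p : SiteY i × ι => ιB (blkOf i.D.toDomains p.1))
                  (conj b ((etaS i ^ 2) • (GpY i (parSymY i) (bgY i U₀)).restrictScalars ℝ) *
                    conj b (diffLetter (shiftY i) (UboxY i (bgY i U₀)) ((|i.cf| : ℝ) : ℂ) (Sum.inr ν)))
                  (fun a a' => A₂ * (geo9K i).len a * Real.exp (-(δ₀ * (geo9K i).dist a a')))) ∧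
                HasMajorant (g := toB6 (geo9K i) 1 Hg) (fun q : BlkY i × ι => ιB q.1)
                  (conj b ((etaS i ^ 2 * etaS i ^ 2)⁻¹ • (XinvY i (parSymY i) (GpY i (parSymY i)) (bgY i U₀)).restrictScalars ℝ))
                  (fun a a' => KT * ((geo9K i).len a ^ 4)⁻¹ * Real.exp (-(δ₀ * (geo9K i).dist a a'))))) →
      (((F.P K).sitesPerDir 0 : ℕ) : ℤ) ∣ (((PV 2 ℓ (F.m + k₀) K hd₃ hL).sitesPerDir 0 : ℕ) : ℤ) ∧
      (((ℓ + 1 : ℕ) : ℤ)) ^ (K - n) ∣ (((F.P K).sitesPerDir 0 : ℕ) : ℤ) ∧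
      Thm2TorusAt (ℓ + 1) (K - n) ((((PV 2 ℓ (F.m + k₀) K hd₃ hL).sitesPerDir 0 : ℕ) : ℤ)) (eta F n K) 0 B₁' B₂ c₁ len
        (specialUnitaryUnits (Fin 2)) (fun _ => True) := by
  letI : CStarAlgebra (Matrix (Fin 2) (Fin 2) ℂ) := {}
  obtain ⟨d', A₁, h8, hgeo⟩ := exists_geo_threshold (d := 2) (hd := hd₃) (hL := hL) (b₀' := (1 : ℝ)) (b₁' := (1 : ℝ)) (instF' := instF)
    (by omega) hδE hαE0 hα1 Hg
  obtain ⟨dg, db, d₁, d₂, d₃, d₄, d₅, dB, dW, A₂, hgeoJ⟩ := exists_geoJ_threshold (d := 2) (hd := hd₃) (hL := hL) (b₀' := (1 : ℝ)) (b₁' := (1 : ℝ))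
    (instF' := instF) (by omega) Hg hδ₀ hαg1 pαg pαb pβb pαst pαst₁ pαst₂ p₁ p₂ p₃ hδ₃0 hαC1 pαC pα₅ pβ₅ pαB pβB pαW₁ pαW₂
  refine ⟨d', dg, db, d₁, d₂, d₃, d₄, d₅, dB, dW, max A₁ A₂, fun a' ha' BE hBE aT haT haTQ haT3 haT2 hεB => ?_⟩
  intro α₀' hα₀ hα₀3 hα₀2 hslack A A₁' A₂' KT hA hA₁ hA₂ hK θE AK hθE hAK hsmallg θF hθF hsmall KK hKK κQ θQ BX θX BY θY B₁ θC κJ hκQ hθQ hBX hθX hBY hθY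
    hB₁ hθC hκJ hθ
  have ha₁ : A₁ ≤ a' := (le_max_left _ _).trans ha'
  have ha₂ : A₂ ≤ a' := (le_max_right _ _).trans ha'
  have h8' : 8 ≤ (ℓ + 1) ^ a' := h8.trans (Nat.pow_le_pow_right (Nat.succ_pos ℓ) ha₁)
  have hSb : 0 ≤ ∑ j, ‖b j‖ := Finset.sum_nonneg fun _ _ => norm_nonneg _
  have hκJ0 : 0 ≤ κJ := (B9B8KnitBondWordDiffAtPars.kappaJ_nonneg (d := 2) hα₀.le hM₂ hSb hA hA₁ hA₂ hK zero_le_one (c1_nonneg _ _ _) (c1_nonneg _ _ _)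
    (c1_nonneg _ _ _) (c1_nonneg _ _ _) zero_le_one zero_le_one hθE hAK hsmallg hθF hκQ hθQ hBX hθX hBY hθY hB₁ hθC hκJ).2
  have hκ' : 0 ≤ (κJ * (M₂ * ∑ j, ‖b j‖) * 1 * B6.c1 dW δW₂ αW₂) := mul_nonneg (mul_nonneg (mul_nonneg hκJ0 (mul_nonneg hM₂ hSb)) zero_le_one) (c1_nonneg _ _ _)
  obtain ⟨a₀', ha₀', k₀, cα, hcα, H⟩ :=
    hThm2Cover_of_prop6_eBlockSym (hd₃ := hd₃) (hL := hL) (len := len) hℓ τ hτ hτt hCτ hM1 d' (Rg := 1) (Hg := Hg) hBE hδE hα1 hκ' hθ haT haTQ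
      haT3 haT2 hεB b hM₂ hrepr Rr Hp h8' (hgeo a' ha₁)
  refine ⟨a₀', ha₀', k₀, cα, hcα, fun cL hcL hαe hcLP hcLα => ?_⟩
  obtain ⟨B₁', B₂, c₁, hB₁', hB₂, hc₁, HT⟩ := H cL hcL hαe hcLP hcLα
  exact ⟨B₁', B₂, c₁, hB₁', hB₂, hc₁, fun F hF n K hnK hΔ =>
    HT F hF n K hnK (jBinder_of_symBinder_constLev (d := 2) (hd := hd₃) (instF := instF) (instD := instD) b hM₂ hrepr pαg hαδg hδc hαb hβb hδb hrb hδ hδ₁ hδ₂ hδ₃ pαst pαst₁ pαst₂ hα'0 hα'1 hδ' hδ'₂ hδ'₃ hαC0 hαδ₄ hα₅ hβ₅ hδ₅ hr₅ hρ hαB hβB hδB hrB hsplit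
      dg db d₁ d₂ d₃ d₄ d₅ dB dW hα₀ hα₀3 hα₀2 hslack hA hA₁ hA₂ hK hθE hAK hsmallg hθF hsmall hKK hκQ hθQ hBX hθX hBY hθY hB₁ hθC hκJ (hgeoJ a' ha₂) hΔ)⟩

end Cover

end Literature.MathematicalPhysics.QuantumFieldTheory.Balaban1983to89.B8Thm2TorusCoverOfEBlockSymJExists

end
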